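import Literature.NumberTheory.GelbartRogawski1991.LocalSplittingCMScaleTransport
import Literature.NumberTheory.GelbartRogawski1991.LocalUnitaryUndoublingQuotientScalar
import Literature.NumberTheory.Automorphic.FiniteAdeleFactorizable
import HarnessLib

/-!
# The doubled CM datum's parabolic eigenfunctional `λ′ = ev₀ ∘ ω^𝔻(m₀ · s w₀)` and the scalar by which a `w₀`-conjugate-Siegel element acts on
# the `N`-coinvariants of the undoubled Weil representation

Topic `NumberTheory/GelbartRogawski1991`; namespace `Literature.NumberTheory.GelbartRogawski1991.UnitaryDualPair.LocalSplitting`.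
KERNEL ONLY: theorems; no definition, no named fact, no instance, no notation, no `sorry`.  Cell `hodgecm-mathlib` (D-0151), programme P2,
N3 road note v2 (`F0/P2/B-p18/g28/N3-ROAD.v2.B-p18g28.md` §2 «STATUS AT SEAT CLOSE»), brick (D3d) THE ASSEMBLER — CM-datum layer over the
group-level core ★ `LocalUnitaryUndoublingQuotientScalar` (lead B-p18 (g28) «=» 20:54:22Z; seat A-p16 (g24)).

SETTING: a CM field `L ⊃ L⁺`, a finite place `v` of `L⁺` with Haar data `μ`, a symmetric invertible `T₀ ∈ M_n(L⁺)`, a unitary splitting character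
`χ` (`IsSplittingChar L 1 χ`); `D := localSplittingDatumCM L v μ n hT₀ hT₀d rfl χ hχ` (Kudla's doubled CM datum at `ℓ_Δ`), `s^𝔻 := D.localSplitting`,
`ω^𝔻 := toRep ∘ s^𝔻` on `𝒮(L⁺_v^{n+n})`, and its undoubling ★ `localSplittingCMWith L n hT₀ hT₀d hJ χ hχ v μ = undoubleLoc s^𝔻` with `ω := toRep ∘ (that)`
on `𝒮(L⁺_v^n)`; an implementer `m₀` carrying `ℓ_Δ` onto `ℓ_Y` (`hm₀`); an element `w₀` of the doubled group with `w₀ w₀ = 1` (the road's hyperbolic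
swap ★ p833527 `lineSwapGL`, packaged by F0P3a-p03 (g8)); `λ′ Φ := (ω^𝔻(m₀ · s^𝔻 w₀) Φ)(0)`.

* §1 `apply_zero_toRep_ne_zero` — `Φ ↦ (ω(m) Φ)(0)` is not identically zero for any implementer `m` (`1_{𝒪^{N}}(0) = 1`; `toRep m` is onto) —
  the input `hne`.
* §2 **`apply_zero_toRep_mul_localSplitting_eq_mul`** — THE EIGEN-LAW: for `p′` with `w₀ p′ w₀ ∈ P_Δ` (`IsSiegelDelta`),
  `λ′ (ω^𝔻(s^𝔻 p′) Φ) = e(w₀ p′ w₀) · λ′ Φ`, `e(p) = χ_v(det_Δ p) · ∏_w ‖det_Δ p_w‖_w^{1/2}` in the tree's spelling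
  `((chiDet … (fun w' => (χ.localComponent w'.1)⁻¹) p)⁻¹ : ℂ) * ∏ w', √‖detDelta … w' p‖` (★ `parabolic_toRep_conj_localSplittingDatumCM` at
  `Φ := ω^𝔻(m₀ · s^𝔻 w₀) Φ`, plus `s^𝔻(w₀) s^𝔻(p′) = s^𝔻(w₀ p′ w₀) s^𝔻(w₀)`); `scalar_eq_one_of_detDelta_eq_one` — `e(p) = 1` when every `det_Δ p_w = 1`.
* §3 **`sub_smul_mem_coinvariantsKer_of_isSiegelDelta_conj`** — THE CM-DATUM ASSEMBLER (sockets = F0P3a-p03's (C3′) heads + the (β) Schur file): for a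
  group `G` read in `U(T₀ ⊗ 1)(L⁺_v)` through `ch`, a subgroup `N ≤ G` with `w₀ (ch n ⊕ 1) w₀ ∈ P_Δ`, `det_Δ = 1` (`hN`), an element `t` with
  `w₀ (ch t ⊕ 1) w₀ ∈ P_Δ` (`ht`), and the Schur input `∃ c′, ∀ f, ω(t) f − c′ • f ∈ K` (`K := Coinvariants.ker (ω|_N)`):
  **`ω(t) f − e(w₀ (ch t ⊕ 1) w₀) • f ∈ K`** for all `f` (★ `sub_smul_mem_coinvariantsKer_of_undoubling_eigenfunctional`).
[Kudla1994, §3 Thm. 3.1; HarrisKudlaSweet1996, §1 (1.15)–(1.16); GelbartRogawski1991, §3.1 Prop. 3.1.1, §3.2 (3.2.2) p. 457; MoeglinVignerasWaldspurger1987,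
Chap. 2 II.1, Chap. 3 §IV.5.]  HC_CM is proved only modulo the printed citations until rung 0 closes; count-neutral helper.

## References
* [Kudla1994] S. Kudla, Israel J. Math. 87 (1994), §3 Thm. 3.1.
* [HarrisKudlaSweet1996] M. Harris, S. Kudla, W. Sweet, J. AMS 9 (1996), §1 (1.11)–(1.16).
* [GelbartRogawski1991] S. Gelbart, J. Rogawski, Invent. Math. 105 (1991), §3.1 Prop. 3.1.1 p. 455; §3.2 (3.2.2) p. 457.
* [MoeglinVignerasWaldspurger1987] LNM 1291 (1987), Chap. 2 II.1; Chap. 3 §IV.5.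
-/

set_option autoImplicit false

noncomputable section

open scoped Matrix
open NumberField IsDedekindDomain MeasureTheory
open Literature.RepresentationTheory.HeisenbergGroup
open Literature.NumberTheory.Automorphic Literature.NumberTheory.Automorphic.UnitaryGroup Literature.NumberTheory.Weil1964
open Literature.NumberTheory.GaloisRepresentations Literature.RepresentationTheory.HarrisKudlaSweet1996

namespace Literature.NumberTheory.GelbartRogawski1991.UnitaryDualPair.LocalSplitting

/-! ## §1 `Φ ↦ (ω(m) Φ)(0)` is not identically zero -/

section EvalZero

variable (F : Type) [Field F] [NumberField F] (N : ℕ) (T : Matrix (Fin N) (Fin N) F) (v : HeightOneSpectrum (𝓞 F))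

/-- **`Φ ↦ (ω(m) Φ)(0)` is NOT identically zero** for any implementer `m ∈ S̃p_ψ(𝕎_v)`: `ω(m)` is a linear automorphism of `𝒮(F_v^N)` and
`1_{𝒪_v^N}(0) = 1`. [cite: MoeglinVignerasWaldspurger1987, Chap. 2 II.1 (B)] -/
theorem apply_zero_toRep_ne_zero (m : LocalMp F N T v) :
    ∃ Φ : SchwartzBruhat (Fin N → v.adicCompletion F),
      ((MpPsi.toRep (localSchrodinger F N T v) m Φ : SchwartzBruhat (Fin N → v.adicCompletion F)) :
        (Fin N → v.adicCompletion F) → ℂ) 0 ≠ 0 := by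
  refine ⟨(m : LocalSp F N T v × (SchwartzBruhat (Fin N → v.adicCompletion F) ≃ₗ[ℂ] SchwartzBruhat (Fin N → v.adicCompletion F))).2.symm
    (unitVec F (Fin N) v), ?_⟩
  rw [MpPsi.toRep_apply, LinearEquiv.apply_symm_apply,
    unitVec_apply_of_mem (z := (0 : Fin N → v.adicCompletion F)) (mem_integralBox_iff.2 fun _ => (v.adicCompletionIntegers F).zero_mem)]
  exact one_ne_zero

end EvalZero

/-! ## §2 The eigen-law of `λ′ = ev₀ ∘ ω^𝔻(m₀ · s^𝔻 w₀)` on `w₀`-conjugate-Siegel elements -/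

section Eigen

variable (L : Type) [Field L] [NumberField L] [IsCMField L] (v : HeightOneSpectrum (𝓞 (maximalRealSubfield L)))
  [MeasurableSpace (v.adicCompletion (maximalRealSubfield L))] [BorelSpace (v.adicCompletion (maximalRealSubfield L))]
  (μ : Measure (v.adicCompletion (maximalRealSubfield L))) [μ.IsAddHaarMeasure]
  (n : ℕ) {T₀ : Matrix (Fin n) (Fin n) (maximalRealSubfield L)} (hT₀ : T₀.IsSymm) (hT₀d : IsUnit T₀.det)
  (χ : HeckeCharacter L) (hχ : IsSplittingChar L 1 χ)
  (m₀ : LocalMp (maximalRealSubfield L) (n + n) (gramD (maximalRealSubfield L) n T₀) v)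
  (hm₀ : (deltaLagrangian (maximalRealSubfield L) v n).map (toLin (maximalRealSubfield L) v (MpPsi.proj _ m₀)) =
    lagrangianY (maximalRealSubfield L) (n + n) v)
  (w₀ : UnitaryGroup.localPi L (IsCMField.complexConj L) (n + n)
    ((gramD (maximalRealSubfield L) n T₀).map (algebraMap (maximalRealSubfield L) L)) v)
  (hw₀ : w₀ * w₀ = 1)

include hw₀ in
set_option maxHeartbeats 4000000 in -- the doubled CM datum's telescope (as in ★ `LocalSplittingCMScaleTransport`)
/-- group bookkeeping: `m₀ · s(w₀) · s(p′) = (m₀ · s(w₀ p′ w₀) · m₀⁻¹) · (m₀ · s(w₀))` when `w₀ w₀ = 1`. [cite: Kudla1994, §3 Thm. 3.1] -/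
theorem mul_localSplitting_swap_mul (p' : UnitaryGroup.localPi L (IsCMField.complexConj L) (n + n)
      ((gramD (maximalRealSubfield L) n T₀).map (algebraMap (maximalRealSubfield L) L)) v) :
    m₀ * (localSplittingDatumCM L v μ n hT₀ hT₀d rfl χ hχ).localSplitting w₀ *
        (localSplittingDatumCM L v μ n hT₀ hT₀d rfl χ hχ).localSplitting p' =
      m₀ * (localSplittingDatumCM L v μ n hT₀ hT₀d rfl χ hχ).localSplitting (w₀ * p' * w₀) * m₀⁻¹ *
        (m₀ * (localSplittingDatumCM L v μ n hT₀ hT₀d rfl χ hχ).localSplitting w₀) := by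
  have hw : w₀ * p' * w₀ * w₀ = w₀ * p' := by rw [mul_assoc, hw₀, mul_one]
  symm
  rw [mul_assoc (m₀ * _) m₀⁻¹ _, inv_mul_cancel_left, mul_assoc m₀, ← map_mul, hw, map_mul, ← mul_assoc]

include hm₀ hw₀ in
set_option maxHeartbeats 4000000 in -- the doubled CM datum's telescope (as in ★ `LocalSplittingCMScaleTransport`)
/-- **THE EIGEN-LAW OF `λ′ = ev₀ ∘ ω^𝔻(m₀ · s^𝔻 w₀)`**: for `p′` with `w₀ p′ w₀ ∈ P_Δ(L⁺_v)`,
`(ω^𝔻(m₀ s^𝔻 w₀) (ω^𝔻(s^𝔻 p′) Φ))(0) = χ_v(det_Δ(w₀ p′ w₀)) · ∏_w ‖det_Δ(w₀ p′ w₀)_w‖_w^{1/2} · (ω^𝔻(m₀ s^𝔻 w₀) Φ)(0)` — the parabolic normalisation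
★ `parabolic_toRep_conj_localSplittingDatumCM` transported by `w₀` (★ p833527 `eigenfunctional_conj`'s group-level form).
[cite: Kudla1994, §3 Thm. 3.1] [cite: HarrisKudlaSweet1996, §1 (1.16)] -/
theorem apply_zero_toRep_mul_localSplitting_eq_mul
    (p' : UnitaryGroup.localPi L (IsCMField.complexConj L) (n + n) ((gramD (maximalRealSubfield L) n T₀).map (algebraMap (maximalRealSubfield L) L)) v)
    (hp : IsSiegelDelta (maximalRealSubfield L) L (IsCMField.complexConj L) (complexConj_imagUnit L) (imagUnit_ne_zero L)
      (imagUnit_mul_self L) v n hT₀ rfl (w₀ * p' * w₀))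
    (Φ : SchwartzBruhat (Fin (n + n) → v.adicCompletion (maximalRealSubfield L))) :
    ((MpPsi.toRep (localSchrodinger (maximalRealSubfield L) (n + n) (gramD (maximalRealSubfield L) n T₀) v)
          (m₀ * (localSplittingDatumCM L v μ n hT₀ hT₀d rfl χ hχ).localSplitting w₀)
          (MpPsi.toRep (localSchrodinger (maximalRealSubfield L) (n + n) (gramD (maximalRealSubfield L) n T₀) v)
            ((localSplittingDatumCM L v μ n hT₀ hT₀d rfl χ hχ).localSplitting p') Φ) :
        SchwartzBruhat (Fin (n + n) → v.adicCompletion (maximalRealSubfield L))) :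
        (Fin (n + n) → v.adicCompletion (maximalRealSubfield L)) → ℂ) 0 =
      (((chiDet (maximalRealSubfield L) L (IsCMField.complexConj L) v n
            (fun w' : PlacesOver L v => (χ.localComponent w'.1)⁻¹) (w₀ * p' * w₀))⁻¹ : ℂˣ) : ℂ) *
        ((∏ w' : PlacesOver L v,
            Real.sqrt ‖detDelta (maximalRealSubfield L) L (IsCMField.complexConj L) v n w' (w₀ * p' * w₀)‖ : ℝ) : ℂ) *
        ((MpPsi.toRep (localSchrodinger (maximalRealSubfield L) (n + n) (gramD (maximalRealSubfield L) n T₀) v)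
            (m₀ * (localSplittingDatumCM L v μ n hT₀ hT₀d rfl χ hχ).localSplitting w₀) Φ :
          SchwartzBruhat (Fin (n + n) → v.adicCompletion (maximalRealSubfield L))) :
          (Fin (n + n) → v.adicCompletion (maximalRealSubfield L)) → ℂ) 0 := by
  have hcomp : MpPsi.toRep (localSchrodinger (maximalRealSubfield L) (n + n) (gramD (maximalRealSubfield L) n T₀) v)
        (m₀ * (localSplittingDatumCM L v μ n hT₀ hT₀d rfl χ hχ).localSplitting w₀)
        (MpPsi.toRep (localSchrodinger (maximalRealSubfield L) (n + n) (gramD (maximalRealSubfield L) n T₀) v)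
          ((localSplittingDatumCM L v μ n hT₀ hT₀d rfl χ hχ).localSplitting p') Φ) =
      MpPsi.toRep (localSchrodinger (maximalRealSubfield L) (n + n) (gramD (maximalRealSubfield L) n T₀) v)
        (m₀ * (localSplittingDatumCM L v μ n hT₀ hT₀d rfl χ hχ).localSplitting (w₀ * p' * w₀) * m₀⁻¹)
        (MpPsi.toRep (localSchrodinger (maximalRealSubfield L) (n + n) (gramD (maximalRealSubfield L) n T₀) v)
          (m₀ * (localSplittingDatumCM L v μ n hT₀ hT₀d rfl χ hχ).localSplitting w₀) Φ) := by
    rw [← Module.End.mul_apply, ← map_mul, mul_localSplitting_swap_mul L v μ n hT₀ hT₀d χ hχ m₀ w₀ hw₀ p', map_mul,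
      Module.End.mul_apply]
  rw [hcomp]
  exact parabolic_toRep_conj_localSplittingDatumCM L v μ n hT₀ hT₀d rfl χ hχ m₀ hm₀ (w₀ * p' * w₀) hp _

omit [MeasurableSpace (v.adicCompletion (maximalRealSubfield L))] [BorelSpace (v.adicCompletion (maximalRealSubfield L))] in
/-- `e(p) = 1` when every `det_Δ p_w = 1` (unipotent-on-`Δ` elements, e.g. `w₀ (n ⊕ 1) w₀` for `n` in the line's unipotent radical).
[cite: HarrisKudlaSweet1996, §1 (1.15)] -/
theorem scalar_eq_one_of_detDelta_eq_one
    (p : UnitaryGroup.localPi L (IsCMField.complexConj L) (n + n) ((gramD (maximalRealSubfield L) n T₀).map (algebraMap (maximalRealSubfield L) L)) v)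
    (hdet : ∀ w' : PlacesOver L v, detDelta (maximalRealSubfield L) L (IsCMField.complexConj L) v n w' p = 1) :
    (((chiDet (maximalRealSubfield L) L (IsCMField.complexConj L) v n (fun w' : PlacesOver L v => (χ.localComponent w'.1)⁻¹) p)⁻¹ : ℂˣ) : ℂ) *
        ((∏ w' : PlacesOver L v, Real.sqrt ‖detDelta (maximalRealSubfield L) L (IsCMField.complexConj L) v n w' p‖ : ℝ) : ℂ) = 1 := by
  classical
  have hchi : chiDet (maximalRealSubfield L) L (IsCMField.complexConj L) v n (fun w' : PlacesOver L v => (χ.localComponent w'.1)⁻¹) p = 1 := by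
    unfold chiDet
    refine Finset.prod_eq_one fun w' _ => ?_
    have hu : IsUnit (detDelta (maximalRealSubfield L) L (IsCMField.complexConj L) v n w' p) := by rw [hdet w']; exact isUnit_one
    rw [dif_pos hu]
    have h1 : hu.unit = 1 := Units.ext (by rw [IsUnit.unit_spec, hdet w', Units.val_one])
    rw [h1, map_one]
  rw [hchi, inv_one, Units.val_one, one_mul]
  have hprod : (∏ w' : PlacesOver L v, Real.sqrt ‖detDelta (maximalRealSubfield L) L (IsCMField.complexConj L) v n w' p‖ : ℝ) = 1 :=
    Finset.prod_eq_one fun w' _ => by rw [hdet w', norm_one, Real.sqrt_one]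
  rw [hprod, Complex.ofReal_one]

end Eigen

/-! ## §3 The CM-datum assembler: ker-level scalar of a `w₀`-conjugate-Siegel element on `r_N(ω)` -/

section Assembler

variable (L : Type) [Field L] [NumberField L] [IsCMField L] (v : HeightOneSpectrum (𝓞 (maximalRealSubfield L)))
  [MeasurableSpace (v.adicCompletion (maximalRealSubfield L))] [BorelSpace (v.adicCompletion (maximalRealSubfield L))]
  (μ : Measure (v.adicCompletion (maximalRealSubfield L))) [μ.IsAddHaarMeasure]
  (n : ℕ) {T₀ : Matrix (Fin n) (Fin n) (maximalRealSubfield L)} (hT₀ : T₀.IsSymm) (hT₀d : IsUnit T₀.det)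
  {J : Matrix (Fin n) (Fin n) L} (hJ : J = T₀.map (algebraMap (maximalRealSubfield L) L))
  (χ : HeckeCharacter L) (hχ : IsSplittingChar L 1 χ)
  (m₀ : LocalMp (maximalRealSubfield L) (n + n) (gramD (maximalRealSubfield L) n T₀) v)
  (hm₀ : (deltaLagrangian (maximalRealSubfield L) v n).map (toLin (maximalRealSubfield L) v (MpPsi.proj _ m₀)) =
    lagrangianY (maximalRealSubfield L) (n + n) v)
  (w₀ : UnitaryGroup.localPi L (IsCMField.complexConj L) (n + n)
    ((gramD (maximalRealSubfield L) n T₀).map (algebraMap (maximalRealSubfield L) L)) v)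
  (hw₀ : w₀ * w₀ = 1)
  {G : Type*} [Group G] (ch : G →* UnitaryGroup.localPi L (IsCMField.complexConj L) n J v) (N : Subgroup G)

include hm₀ hw₀ in
set_option maxHeartbeats 4000000 in -- the doubled CM datum's telescope (as in ★ `LocalSplittingCMScaleTransport`)
/-- **THE CM-DATUM ASSEMBLER (ker-level).**  Let `N ≤ G` consist of elements whose `w₀ (ch n ⊕ 1) w₀` lie in `P_Δ` with `det_Δ = 1` (`hN`), let `t ∈ G`
have `w₀ (ch t ⊕ 1) w₀ ∈ P_Δ` (`ht`), and suppose `t` acts on `r_N(ω)`, `ω = toRep ∘ localSplittingCMWith … v μ ∘ ch`, by SOME scalar (`hSchur`).  Then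
`ω(t) f − e • f ∈ Coinvariants.ker (ω|_N)` for all `f`, with `e = χ_v(det_Δ p) · ∏_w ‖det_Δ p_w‖_w^{1/2}`, `p = w₀ (ch t ⊕ 1) w₀`.
[cite: Kudla1994, §3 Thm. 3.1] [cite: GelbartRogawski1991, §3.2 (3.2.2) p. 457] [cite: MoeglinVignerasWaldspurger1987, Chap. 3 §IV.5] -/
theorem sub_smul_mem_coinvariantsKer_of_isSiegelDelta_conj
    (hN : ∀ nn ∈ N, IsSiegelDelta (maximalRealSubfield L) L (IsCMField.complexConj L) (complexConj_imagUnit L) (imagUnit_ne_zero L)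
        (imagUnit_mul_self L) v n hT₀ rfl (w₀ * inlLoc (maximalRealSubfield L) L (IsCMField.complexConj L) v n hJ rfl (ch nn) * w₀) ∧
      ∀ w' : PlacesOver L v, detDelta (maximalRealSubfield L) L (IsCMField.complexConj L) v n w'
        (w₀ * inlLoc (maximalRealSubfield L) L (IsCMField.complexConj L) v n hJ rfl (ch nn) * w₀) = 1)
    (t : G)
    (ht : IsSiegelDelta (maximalRealSubfield L) L (IsCMField.complexConj L) (complexConj_imagUnit L) (imagUnit_ne_zero L)
        (imagUnit_mul_self L) v n hT₀ rfl (w₀ * inlLoc (maximalRealSubfield L) L (IsCMField.complexConj L) v n hJ rfl (ch t) * w₀))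
    (hSchur : ∃ c' : ℂ, ∀ f : SchwartzBruhat (Fin n → v.adicCompletion (maximalRealSubfield L)),
      MpPsi.toRep (localSchrodinger (maximalRealSubfield L) n T₀ v) (localSplittingCMWith L n hT₀ hT₀d hJ χ hχ v μ (ch t)) f - c' • f ∈
        Representation.Coinvariants.ker
          ((((MpPsi.toRep (localSchrodinger (maximalRealSubfield L) n T₀ v)).comp (localSplittingCMWith L n hT₀ hT₀d hJ χ hχ v μ)).comp ch).comp
            N.subtype))
    (f : SchwartzBruhat (Fin n → v.adicCompletion (maximalRealSubfield L))) :
    MpPsi.toRep (localSchrodinger (maximalRealSubfield L) n T₀ v) (localSplittingCMWith L n hT₀ hT₀d hJ χ hχ v μ (ch t)) f -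
        ((((chiDet (maximalRealSubfield L) L (IsCMField.complexConj L) v n (fun w' : PlacesOver L v => (χ.localComponent w'.1)⁻¹)
              (w₀ * inlLoc (maximalRealSubfield L) L (IsCMField.complexConj L) v n hJ rfl (ch t) * w₀))⁻¹ : ℂˣ) : ℂ) *
          ((∏ w' : PlacesOver L v, Real.sqrt ‖detDelta (maximalRealSubfield L) L (IsCMField.complexConj L) v n w'
              (w₀ * inlLoc (maximalRealSubfield L) L (IsCMField.complexConj L) v n hJ rfl (ch t) * w₀)‖ : ℝ) : ℂ)) • f ∈
      Representation.Coinvariants.ker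
        ((((MpPsi.toRep (localSchrodinger (maximalRealSubfield L) n T₀ v)).comp (localSplittingCMWith L n hT₀ hT₀d hJ χ hχ v μ)).comp ch).comp
          N.subtype) := by
  -- `λ′ := ev₀ ∘ ω^𝔻(m₀ · s^𝔻 w₀)` as a linear functional
  obtain ⟨lam, hlam⟩ : ∃ lam : SchwartzBruhat (Fin (n + n) → v.adicCompletion (maximalRealSubfield L)) →ₗ[ℂ] ℂ, ∀ Φ, lam Φ =
      ((MpPsi.toRep (localSchrodinger (maximalRealSubfield L) (n + n) (gramD (maximalRealSubfield L) n T₀) v)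
          (m₀ * (localSplittingDatumCM L v μ n hT₀ hT₀d rfl χ hχ).localSplitting w₀) Φ :
        SchwartzBruhat (Fin (n + n) → v.adicCompletion (maximalRealSubfield L))) :
        (Fin (n + n) → v.adicCompletion (maximalRealSubfield L)) → ℂ) 0 :=
    ⟨(LinearMap.proj (0 : Fin (n + n) → v.adicCompletion (maximalRealSubfield L))) ∘ₗ
        (SchwartzBruhat (Fin (n + n) → v.adicCompletion (maximalRealSubfield L))).subtype ∘ₗ
        (MpPsi.toRep (localSchrodinger (maximalRealSubfield L) (n + n) (gramD (maximalRealSubfield L) n T₀) v)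
          (m₀ * (localSplittingDatumCM L v μ n hT₀ hT₀d rfl χ hχ).localSplitting w₀)), fun _ => rfl⟩
  -- `λ′ ≠ 0`
  have hne : lam ≠ 0 := by
    obtain ⟨Φ, hΦ⟩ := apply_zero_toRep_ne_zero (maximalRealSubfield L) (n + n) (gramD (maximalRealSubfield L) n T₀) v
      (m₀ * (localSplittingDatumCM L v μ n hT₀ hT₀d rfl χ hχ).localSplitting w₀)
    intro h0
    apply hΦ
    rw [← hlam, h0, LinearMap.zero_apply]
  -- invariance under `N` (eigenvalue `1`) and the eigen-law at `t`
  have hinv : ∀ nn ∈ N, ∀ Φ, lam (MpPsi.toRep (localSchrodinger (maximalRealSubfield L) (n + n) (gramD (maximalRealSubfield L) n T₀) v)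
      ((localSplittingDatumCM L v μ n hT₀ hT₀d rfl χ hχ).localSplitting
        (inlLoc (maximalRealSubfield L) L (IsCMField.complexConj L) v n hJ rfl (ch nn))) Φ) = lam Φ := by
    intro nn hnn Φ
    obtain ⟨hp, hdet⟩ := hN nn hnn
    rw [hlam, hlam, apply_zero_toRep_mul_localSplitting_eq_mul L v μ n hT₀ hT₀d χ hχ m₀ hm₀ w₀ hw₀ _ hp,
      scalar_eq_one_of_detDelta_eq_one L v n χ _ hdet, one_mul]
  have heig : ∀ Φ, lam (MpPsi.toRep (localSchrodinger (maximalRealSubfield L) (n + n) (gramD (maximalRealSubfield L) n T₀) v)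
      ((localSplittingDatumCM L v μ n hT₀ hT₀d rfl χ hχ).localSplitting
        (inlLoc (maximalRealSubfield L) L (IsCMField.complexConj L) v n hJ rfl (ch t))) Φ) =
      ((((chiDet (maximalRealSubfield L) L (IsCMField.complexConj L) v n (fun w' : PlacesOver L v => (χ.localComponent w'.1)⁻¹)
              (w₀ * inlLoc (maximalRealSubfield L) L (IsCMField.complexConj L) v n hJ rfl (ch t) * w₀))⁻¹ : ℂˣ) : ℂ) *
          ((∏ w' : PlacesOver L v, Real.sqrt ‖detDelta (maximalRealSubfield L) L (IsCMField.complexConj L) v n w'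
              (w₀ * inlLoc (maximalRealSubfield L) L (IsCMField.complexConj L) v n hJ rfl (ch t) * w₀)‖ : ℝ) : ℂ)) * lam Φ := by
    intro Φ
    rw [hlam, hlam, apply_zero_toRep_mul_localSplitting_eq_mul L v μ n hT₀ hT₀d χ hχ m₀ hm₀ w₀ hw₀ _ ht]
  -- the group-level core ★ `sub_smul_mem_coinvariantsKer_of_undoubling_eigenfunctional`
  exact sub_smul_mem_coinvariantsKer_of_undoubling_eigenfunctional (maximalRealSubfield L) L (IsCMField.complexConj L) v n hJ rfl
    (complexConj_imagUnit L) (imagUnit_ne_zero L) (imagUnit_mul_self L) hT₀ hT₀d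
    (localSplittingDatumCM L v μ n hT₀ hT₀d rfl χ hχ).localSplitting
    (fun g => (localSplittingDatumCM L v μ n hT₀ hT₀d rfl χ hχ).proj_localSplitting g) ch N lam hne hinv t _ heig hSchur f

end Assembler

end Literature.NumberTheory.GelbartRogawski1991.UnitaryDualPair.LocalSplitting

end
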